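import Summits.QuantumFields.BalabanUV.Beta.GAN24.DressedSourceExchangeWords
import Summits.QuantumFields.BalabanUV.Beta.GAN24.VHWordsZeroAllLevels
import Summits.QuantumFields.BalabanUV.Beta.GAN24.EVHLatticeWordsSucc
import Summits.QuantumFields.BalabanUV.Beta.GAN24.DressedSourceZeroModeLevelZero
import Summits.QuantumFields.BalabanUV.Beta.GAN24.CurrentSymTower

/-!
# `BalabanUV.Beta.GAN24.DressedSourceZeroModeSucc` — binder row G-an2-4 ∕ (CONV-C), W-slot CT-W, conservation law (C)∕(C)sym AT ALL LEVELS, 33_j CLOSED MODULO THE EE CHANNEL (this lineage's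
# ledger, `HOME/b2b-balaban-gan24-formalise-leaf-04/g69/CURRENT-SYM-TOWER.md`): **THE ff ZERO MODE OF THE DRESSED LEVEL-`(j+1)` SOURCE IS ITS TWO `S^E ⊗ S^E` LATTICE WORDS** — 33
# `DressedSourceZeroModeLevelZero.zmode_dressedSource_level0_inl_inl` with `0 ↦ j+1`: 21 (every `j`) + 30_{j+1} `DressedSourceExchangeWordsSucc` (both exchange words = their EE words) + 32
# (every `j`: the `K·W·K` word is half the outer-summed second-response words) + (L3c)_{j+1} `RespWordsAllLevels.respWords_add_swap_eq_zero` (those words cancel).  The EE words are the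
# (γ) hand's (leaf-06 (W1)–(W7)); nothing of them is asserted.  Pins: E's Ward values `cE = Lc^{d+1}`, `cVH = −Lc^{d+1}·½·Lc^{d+1}`, `3 ≤ Lc`.

ONE MODULE, TWO PARTS (leaf-04 gen 70, 2026-08-23): Part A = gen 69's staged 30_j `DressedSourceExchangeWordsSucc` (namespace `…GAN24.DressedSourceExchangeWordsSucc`: `sum_box_tsum_direct_word_eq_ee_succ` ∕
`sum_box_tsum_swap_word_eq_ee_succ`; never filed as a separate module) and Part B = gen 69's staged 33_j (namespace `…GAN24.DressedSourceZeroModeSucc`), each a complete `noncomputable section`,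
bytes of both bodies UNCHANGED from the twins certified together by gen 69's concat cert `Concat_33j_40body` (rc 0, 0 sorry) — except the import of (L3c)_j, now the merged module
`GAN24.CurrentSymTower` (Part B there = the staged `RespWordsAllLevels`); merged only to shorten the gate's olean chain.

NOT IN PRINT; OUR BOOKKEEPING ([folklore] one `rw` chain; G-an2-4 formalisation swarm, leaf prover `b2b-balaban-gan24-formalise-leaf-04`, gen 69).  HONEST FRAMING (cell contract, verbatim):
«discharging `BetaPertH` makes Bałaban's UV stability UNCONDITIONAL — a real constructive-QFT result; it is NOT the continuum limit and NOT the Clay problem.»  HONEST DEPENDENCY (verbatim):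
«continuum YM on T⁴ ⇐ BetaPertH ∧ nine spine estimates (0/9 proved); BetaPertH ⇐ (D1) ∧ (D4) ∧ CAP+tail; G-an2-4 gates asym, D1 and NE2/3/4.»

WHAT ([folklore]; generic `d`, `3 ≤ Lc`, in-block root, every `j`, all units, every `cΛ`, E's pins, scalars `c cB`; ANY block-covariant multiplier vertex family `M` at a positive rate, ANY
jointly block-covariant mixed table `M₂`, ANY border `B` without ff block; any axes; 0 `def`, 0 cited facts, 0 `def … : Prop`, 0 sorry): `exists_succ_data`, **`zmode_dressedSource_succ_inl_inl`**,
**`zmode_dressedSource_succ_an1_inl_inl`** (the same at an1's tables `M = unitM s_f s_m (M1At … (j+1))`, `M₂ = unitM₂ s_f s_m (M2Of d Lc (mixFFAt ρ Lc) (j+1))` — p2's literal source).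
Asserts NO value of Bałaban's tables; discharges NOTHING of (C)sym ∕ (Q-D) ∕ (Q-D-rate) ∕ «T2Shape» ∕ «T2Drift» ∕ (hW, hWall); NEVER «G-an2-4 closed» as (CONV-C); NOT D1, NOT `BetaPertH`,
NOT continuum, NOT Clay.  2026-08-23; no existing file touched.
-/

/-!
# Part A (staged module name `GAN24.DressedSourceExchangeWordsSucc`, merged here, never filed separately) — binder row G-an2-4 ∕ (CONV-C), W-slot CT-W, conservation law (C)∕(C)sym AT ALL LEVELS, 30_j of this lineage's ledger
# (`HOME/b2b-balaban-gan24-formalise-leaf-04/g69/CURRENT-SYM-TOWER.md`): **AT LEVEL `j+1` BOTH EXCHANGE WORDS OF THE ff ZERO MODE OF THE DRESSED SOURCE REDUCE TO THEIR `S^E ⊗ S^E`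
# LATTICE WORDS** — 30 `DressedSourceExchangeWords.sum_box_tsum_direct_word_eq ∕ _swap_word_eq` with `0 ↦ j+1`: the `3 × 3` sector split `dM = V^E + V^VH + V^M` in both slots, and the eight
# non-EE sector words killed by 23 (`M`-words, every `j`), 26 (`VH ⊗ VH`, every `j`), 24_{j+1} (`VHWordsZeroAllLevels`, this gen) and 27_{j+1} (`EVHLatticeWordsSucc`, this gen); the EE word is
# left for the (γ) hand (leaf-06's (W1)–(W7)).  Pins: E's Ward values `cE = Lc^{d+1}`, `cVH = −Lc^{d+1}·½·Lc^{d+1}`, `3 ≤ Lc`.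

WHAT ([folklore]; generic `d`, `3 ≤ Lc`, in-block root, every `j`, all units `s_f s_m`, every `cΛ`, E's pins, ANY block-covariant multiplier vertex family `M` at a positive rate, ANY local
partner border; any axes; 0 `def`, 0 cited facts, 0 `def … : Prop`, 0 sorry): `dM_dressed_succ_split`, `exists_sector_data_succ`, **`sum_box_tsum_direct_word_eq_ee_succ`**,
**`sum_box_tsum_swap_word_eq_ee_succ`**.  Asserts NO value of Bałaban's tables; discharges NOTHING of (C)sym ∕ (Q-D) ∕ (Q-D-rate) ∕ «T2Shape» ∕ «T2Drift» ∕ (hW, hWall); NEVER «G-an2-4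
closed» as (CONV-C); NOT D1, NOT `BetaPertH`, NOT continuum, NOT Clay.  2026-08-23; no existing file touched.
-/

noncomputable section

open Finset
open scoped BigOperators
open Literature.MathematicalPhysics.QuantumFieldTheory
open Literature.MathematicalPhysics.QuantumFieldTheory.Balaban1983to89
open Literature.MathematicalPhysics.QuantumFieldTheory.Balaban1983to89.Beta
open ExpKernelCalculus (Site MKer comp shiftK Decays BiLoc VertexFamily)
open OneStepResolventKernel (Fib LocStencil decays_mono biLoc_mono)
open OneStepKernelFamily (KInvStep vertexOfK vertexFamily_vertexOfK decays_KInvStep)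
open SecondOrderResponse (dM vertexOfM vertexFamily_vertexOfM)
open BalabanStepJetsSucc (wE wVH)
open AffineAveraging (box toSite)
open AveragingHessianKernelsRooted (vhSAt)
open Summit.QuantumFields.BalabanUV.Beta.TameKernelCalculus (Loc Spr)
open Summit.QuantumFields.BalabanUV.Beta.AxialDressingRooted (coDressKBmAt decays_coDressKBmAt)
open Summit.QuantumFields.BalabanUV.Beta.HessKerDressedUnits (unitK unitS decays_unitK locStencil_unitS)
open Summit.QuantumFields.BalabanUV.Beta.SpineRooted (e3OfK SpureRecAt SpureRecAt_succ)
open Summit.QuantumFields.BalabanUV.Beta.WardLocusRecursive (SrecAt)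
open Summit.QuantumFields.BalabanUV.Beta.GAN24.ExchangeSlotResum (face_weight_periodic)
open Summit.QuantumFields.BalabanUV.Beta.GAN24.MultiplierWordsZero (tsum_right_vertexOfM_word_eq_zero tsum_left_vertexOfM_word_eq_zero tsum_vertexOfM_left_cov_word_eq_zero
  tsum_vertexOfM_right_cov_word_eq_zero)
open Summit.QuantumFields.BalabanUV.Beta.GAN24.VHWordsZeroVhSAt (locStencil_vhS vhS_inl_inl vhS_translate vhS_inr_fst_eq_zero vhS_inr_snd_eq_zero sum_box_vh_vh_words_eq_zero)
open Summit.QuantumFields.BalabanUV.Beta.GAN24.VHWordsZeroBorder (borderSlot_translate)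
open Summit.QuantumFields.BalabanUV.Beta.GAN24.TwoFaceWordAdditive (dM_unitS_add)
open Summit.QuantumFields.BalabanUV.Beta.GAN24.DressedSourceExchangeWords (tsum_direct_word_split tsum_swap_word_split)
open Summit.QuantumFields.BalabanUV.Beta.GAN24.VHWordsZeroLatticeStep (exists_locStencil_e3Sector vertexE_translate)
open Summit.QuantumFields.BalabanUV.Beta.GAN24.VHWordsZeroAllLevels (vhE_word_eq_zero_succ EvH_swap_word_eq_zero_succ)
open Summit.QuantumFields.BalabanUV.Beta.GAN24.EVHLatticeWordsSucc (sum_box_E_border_word_eq_zero_succ sum_box_border_E_swap_word_eq_zero_succ)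

namespace Summit.QuantumFields.BalabanUV.Beta.GAN24.DressedSourceExchangeWordsSucc

variable {d : ℕ} {Lc : ℕ} [NeZero Lc] {r : Fin (d + 1) → ℕ} {M : Fin (d + 1) → Site (d + 1) → MKer (d + 1) (Fib d)} {CM δM : ℝ} {μ ν α β : Fin (d + 1)}

/-- [folklore] **THE SECTOR SPLIT OF THE BACKGROUND DERIVATIVE AT LEVEL `j+1`**: `dM X̃_{j+1} Lc S♮_{j+1} M = V^E + (V^VH + V^M)` (`SpureRecAt_succ`, 29 `dM_unitS_add`). -/
theorem dM_dressed_succ_split (hr : r ∈ box (d + 1) Lc) (sf sm cE cVH cΛ : ℝ) (j : ℕ) (M : Fin (d + 1) → Site (d + 1) → MKer (d + 1) (Fib d)) (μ : Fin (d + 1)) (u : Site (d + 1)) :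
    dM (unitK sf sm (coDressKBmAt (toSite r) Lc (KInvStep (d := d) Lc (j + 1)))) Lc (unitS sf sm (SpureRecAt d Lc (toSite r) cE cVH cΛ (j + 1))) M μ u =
      vertexOfK (unitK sf sm (coDressKBmAt (toSite r) Lc (KInvStep (d := d) Lc (j + 1)))) Lc
          (unitS sf sm (fun κ t => (cE * wE d Lc (j + 1)) • e3OfK Lc (coDressKBmAt (toSite r) Lc (KInvStep (d := d) Lc j)) (SrecAt d Lc (toSite r) cE cVH cΛ j) κ t)) μ u +
        (vertexOfK (unitK sf sm (coDressKBmAt (toSite r) Lc (KInvStep (d := d) Lc (j + 1)))) Lc (unitS sf sm (fun κ v => (cVH * wVH d Lc (j + 1)) • vhSAt (toSite r) d Lc rfl κ v)) μ u +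
          vertexOfM (unitK sf sm (coDressKBmAt (toSite r) Lc (KInvStep (d := d) Lc (j + 1)))) Lc M μ u) := by
  have hLc : 1 ≤ Lc := Nat.one_le_iff_ne_zero.mpr (NeZero.ne Lc)
  obtain ⟨δK, CK, hδK, hCK, hXd⟩ := decays_coDressKBmAt hLc hr (decays_KInvStep (d := d) (Lc := Lc) (j + 1))
  have hXu := decays_unitK (sf := sf) (sm := sm) hXd
  obtain ⟨CE, δE, hδE, hSE⟩ := exists_locStencil_e3Sector (d := d) hLc hr cE cVH cΛ j
  have hSV := locStencil_vhS hLc hr (cVH * wVH d Lc (j + 1)) (le_refl (0 : ℝ))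
  rw [SpureRecAt_succ, dM_unitS_add (N := Lc) hXu hδK sf sm hSE hδE.le hSV le_rfl M μ u]
  rfl

/-- [folklore] **DATA OF THE THREE SECTOR FAMILIES AT LEVEL `j+1`** (one rate). -/
theorem exists_sector_data_succ (hr : r ∈ box (d + 1) Lc) (sf sm cE cVH cΛ : ℝ) (j : ℕ) (hM : VertexFamily M Lc CM δM) (hδM : 0 < δM) :
    ∃ δ CX Cv Cw Cm : ℝ, 0 < δ ∧ Decays (unitK sf sm (coDressKBmAt (toSite r) Lc (KInvStep (d := d) Lc (j + 1)))) CX δ ∧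
      VertexFamily (vertexOfK (unitK sf sm (coDressKBmAt (toSite r) Lc (KInvStep (d := d) Lc (j + 1)))) Lc
        (unitS sf sm (fun κ t => (cE * wE d Lc (j + 1)) • e3OfK Lc (coDressKBmAt (toSite r) Lc (KInvStep (d := d) Lc j)) (SrecAt d Lc (toSite r) cE cVH cΛ j) κ t))) Lc Cv δ ∧
      VertexFamily (vertexOfK (unitK sf sm (coDressKBmAt (toSite r) Lc (KInvStep (d := d) Lc (j + 1)))) Lc (unitS sf sm (fun κ v => (cVH * wVH d Lc (j + 1)) • vhSAt (toSite r) d Lc rfl κ v))) Lc Cw δ ∧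
      VertexFamily (vertexOfM (unitK sf sm (coDressKBmAt (toSite r) Lc (KInvStep (d := d) Lc (j + 1)))) Lc M) Lc Cm δ := by
  have hLc : 1 ≤ Lc := Nat.one_le_iff_ne_zero.mpr (NeZero.ne Lc)
  obtain ⟨δK, CK, hδK, hCK, hXd⟩ := decays_coDressKBmAt hLc hr (decays_KInvStep (d := d) (Lc := Lc) (j + 1))
  have hXu := decays_unitK (sf := sf) (sm := sm) hXd
  have hCX : 0 ≤ max |sf| |sm| * CK * max |sf| |sm| := by positivity
  have hCM : 0 ≤ CM := (hM 0 0).nonneg (Sum.inl 0)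
  obtain ⟨CE, δE, hδE, hSE⟩ := exists_locStencil_e3Sector (d := d) hLc hr cE cVH cΛ j
  have hCE : 0 ≤ CE := (hSE 0 0).nonneg (Sum.inl 0)
  set δ₁ : ℝ := min δK (min δM δE) with hδ₁
  have hδ₁0 : 0 < δ₁ := lt_min hδK (lt_min hδM hδE)
  have hX1 : Decays (unitK sf sm (coDressKBmAt (toSite r) Lc (KInvStep (d := d) Lc (j + 1)))) (max |sf| |sm| * CK * max |sf| |sm|) δ₁ := decays_mono hXu hCX le_rfl (min_le_left _ _)
  have hM1 : VertexFamily M Lc CM δ₁ := fun ρ' w => biLoc_mono (hM ρ' w) hCM ((min_le_right _ _).trans (min_le_left _ _))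
  have hVE := vertexFamily_vertexOfK (N := Lc) hX1 hCX (locStencil_unitS (sf := sf) (sm := sm) (fun κ u => biLoc_mono (hSE κ u) hCE ((min_le_right _ _).trans (min_le_right _ _)))) hδ₁0 le_rfl
  have hVW := vertexFamily_vertexOfK (N := Lc) hX1 hCX (locStencil_unitS (sf := sf) (sm := sm) (locStencil_vhS hLc hr (cVH * wVH d Lc (j + 1)) hδ₁0.le)) hδ₁0 le_rfl
  have hVM := vertexFamily_vertexOfM hX1 hCX hM1 hδ₁0 le_rfl
  exact ⟨δ₁ / 2, _, _, _, _, half_pos hδ₁0, decays_mono hX1 hCX le_rfl (by linarith), hVE, hVW, hVM⟩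

/-- [folklore] **30_{j+1}, DIRECT: THE DIRECT EXCHANGE WORD OF THE DRESSED LEVEL-`(j+1)` SOURCE'S ff ZERO MODE IS ITS `S^E ⊗ S^E` LATTICE WORD** (E's pins, `3 ≤ Lc`, all units, every `cΛ`, ANY
block-covariant multiplier vertex family `M` at a positive rate, any axes). -/
theorem sum_box_tsum_direct_word_eq_ee_succ (hLc : 3 ≤ Lc) (hr : r ∈ box (d + 1) Lc) (sf sm cΛ : ℝ) (j : ℕ) (hM : VertexFamily M Lc CM δM) (hδM : 0 < δM)
    (hMcov : ∀ (ρ' : Fin (d + 1)) (w t : Site (d + 1)), M ρ' (w + t) = shiftK (-((Lc : ℤ) • t)) (M ρ' w)) :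
    ∑ c ∈ box (d + 1) Lc, ∑' u' : Site (d + 1), ∑' yw : Site (d + 1) × Site (d + 1), (if yw.1 α % (Lc : ℤ) = (Lc : ℤ) - 1 then (1 : ℝ) else 0) * (if yw.2 β % (Lc : ℤ) = (Lc : ℤ) - 1 then (1 : ℝ) else 0) *
        comp (comp (dM (unitK sf sm (coDressKBmAt (toSite r) Lc (KInvStep (d := d) Lc (j + 1)))) Lc
            (unitS sf sm (SpureRecAt d Lc (toSite r) ((Lc : ℝ) ^ (d + 1)) (-((Lc : ℝ) ^ (d + 1) * (1 / 2) * (Lc : ℝ) ^ (d + 1))) cΛ (j + 1))) M μ (toSite c))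
          (unitK sf sm (coDressKBmAt (toSite r) Lc (KInvStep (d := d) Lc (j + 1)))))
          (dM (unitK sf sm (coDressKBmAt (toSite r) Lc (KInvStep (d := d) Lc (j + 1)))) Lc
            (unitS sf sm (SpureRecAt d Lc (toSite r) ((Lc : ℝ) ^ (d + 1)) (-((Lc : ℝ) ^ (d + 1) * (1 / 2) * (Lc : ℝ) ^ (d + 1))) cΛ (j + 1))) M ν u') yw.1 yw.2 (Sum.inl α) (Sum.inl β) =
      ∑ c ∈ box (d + 1) Lc, ∑' u' : Site (d + 1), ∑' yw : Site (d + 1) × Site (d + 1), (if yw.1 α % (Lc : ℤ) = (Lc : ℤ) - 1 then (1 : ℝ) else 0) * (if yw.2 β % (Lc : ℤ) = (Lc : ℤ) - 1 then (1 : ℝ) else 0) *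
        comp (comp (vertexOfK (unitK sf sm (coDressKBmAt (toSite r) Lc (KInvStep (d := d) Lc (j + 1)))) Lc
            (unitS sf sm (fun κ t => ((Lc : ℝ) ^ (d + 1) * wE d Lc (j + 1)) • e3OfK Lc (coDressKBmAt (toSite r) Lc (KInvStep (d := d) Lc j))
              (SrecAt d Lc (toSite r) ((Lc : ℝ) ^ (d + 1)) (-((Lc : ℝ) ^ (d + 1) * (1 / 2) * (Lc : ℝ) ^ (d + 1))) cΛ j) κ t)) μ (toSite c))
          (unitK sf sm (coDressKBmAt (toSite r) Lc (KInvStep (d := d) Lc (j + 1)))))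
          (vertexOfK (unitK sf sm (coDressKBmAt (toSite r) Lc (KInvStep (d := d) Lc (j + 1)))) Lc
            (unitS sf sm (fun κ t => ((Lc : ℝ) ^ (d + 1) * wE d Lc (j + 1)) • e3OfK Lc (coDressKBmAt (toSite r) Lc (KInvStep (d := d) Lc j))
              (SrecAt d Lc (toSite r) ((Lc : ℝ) ^ (d + 1)) (-((Lc : ℝ) ^ (d + 1) * (1 / 2) * (Lc : ℝ) ^ (d + 1))) cΛ j) κ t)) ν u') yw.1 yw.2 (Sum.inl α) (Sum.inl β) := by
  classical
  have hLc1 : 1 ≤ Lc := le_trans (by norm_num) hLc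
  obtain ⟨δ, CX, Cv, Cw, Cm, hδ, hXd, hVE, hVW, hVM⟩ := exists_sector_data_succ hr sf sm ((Lc : ℝ) ^ (d + 1)) (-((Lc : ℝ) ^ (d + 1) * (1 / 2) * (Lc : ℝ) ^ (d + 1))) cΛ j hM hδM
  have hX : Spr (unitK sf sm (coDressKBmAt (toSite r) Lc (KInvStep (d := d) Lc (j + 1)))) := ⟨_, _, hδ, hXd⟩
  have hLE := fun (κ : Fin (d + 1)) (u : Site (d + 1)) => (⟨_, _, _, _, hδ, hVE κ u⟩ : Loc _)
  have hLW := fun (κ : Fin (d + 1)) (u : Site (d + 1)) => (⟨_, _, _, _, hδ, hVW κ u⟩ : Loc _)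
  have hLM := fun (κ : Fin (d + 1)) (u : Site (d + 1)) => (⟨_, _, _, _, hδ, hVM κ u⟩ : Loc _)
  have hρα : ∀ y : Site (d + 1), |(if y α % (Lc : ℤ) = (Lc : ℤ) - 1 then (1 : ℝ) else 0)| ≤ 1 := fun y => by split_ifs <;> simp
  have hρβ : ∀ w : Site (d + 1), |(if w β % (Lc : ℤ) = (Lc : ℤ) - 1 then (1 : ℝ) else 0)| ≤ 1 := fun w => by split_ifs <;> simp
  have hEcov := fun (κ : Fin (d + 1)) (u t : Site (d + 1)) => vertexE_translate (r := r) hLc1 sf sm ((Lc : ℝ) ^ (d + 1)) (-((Lc : ℝ) ^ (d + 1) * (1 / 2) * (Lc : ℝ) ^ (d + 1))) cΛ j κ u t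
  have hWcov := fun (κ : Fin (d + 1)) (u t : Site (d + 1)) =>
    borderSlot_translate (r := r) (S' := fun κ v => (-((Lc : ℝ) ^ (d + 1) * (1 / 2) * (Lc : ℝ) ^ (d + 1)) * wVH d Lc (j + 1)) • vhSAt (toSite r) d Lc rfl κ v) hLc1 sf sm (j + 1)
      (vhS_translate (r := r) hLc1 (-((Lc : ℝ) ^ (d + 1) * (1 / 2) * (Lc : ℝ) ^ (d + 1)) * wVH d Lc (j + 1))) κ u t
  have hSV := locStencil_vhS hLc1 hr (-((Lc : ℝ) ^ (d + 1) * (1 / 2) * (Lc : ℝ) ^ (d + 1)) * wVH d Lc (j + 1)) zero_le_one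
  -- split both slots and the lattice sum
  simp only [dM_dressed_succ_split hr sf sm ((Lc : ℝ) ^ (d + 1)) (-((Lc : ℝ) ^ (d + 1) * (1 / 2) * (Lc : ℝ) ^ (d + 1))) cΛ j M]
  rw [Finset.sum_congr rfl fun c _ => tsum_direct_word_split (hLE μ (toSite c)) (hLW μ (toSite c)) (hLM μ (toSite c)) hX hVE hδ hVW hδ hVM hδ hρα hρβ ν (Sum.inl α) (Sum.inl β)]
  simp only [Finset.sum_add_distrib]
  -- the eight sector zeros
  have z12 := sum_box_E_border_word_eq_zero_succ (μ := μ) (ν := ν) (α := α) (β := β) hLc hr sf sm cΛ j hSV one_pos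
    (vhS_inl_inl (r := r) _) (vhS_translate (r := r) hLc1 _) (vhS_inr_fst_eq_zero (r := r) _)
  have z13 : ∀ c : Site (d + 1), _ := fun c => tsum_right_vertexOfM_word_eq_zero hLc1 hr sf sm (j + 1) hM hδM (hLE μ c) hρα hρβ ν (Sum.inl α) (Sum.inl β)
  have z21 : ∀ c : Site (d + 1), _ := fun c => vhE_word_eq_zero_succ (μ := μ) (ν := ν) (α := α) (β := β) hLc hr sf sm cΛ j hSV one_pos (vhS_inl_inl (r := r) _) c
  have z22 := (sum_box_vh_vh_words_eq_zero (μ := μ) (ν := ν) (α := α) (β := β) hLc1 hr sf sm (-((Lc : ℝ) ^ (d + 1) * (1 / 2) * (Lc : ℝ) ^ (d + 1)) * wVH d Lc (j + 1)) (j + 1) Lc).1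
  have z23 : ∀ c : Site (d + 1), _ := fun c => tsum_right_vertexOfM_word_eq_zero hLc1 hr sf sm (j + 1) hM hδM (hLW μ c) hρα hρβ ν (Sum.inl α) (Sum.inl β)
  have z31 : ∀ c : Site (d + 1), _ := fun c => tsum_vertexOfM_left_cov_word_eq_zero hLc1 hr sf sm (j + 1) hM hδM hMcov hVE hδ hEcov
    (fun y s => face_weight_periodic Lc α y s) (fun w s => face_weight_periodic Lc β w s) hρα hρβ μ ν (Sum.inl α) (Sum.inl β) c
  have z32 : ∀ c : Site (d + 1), _ := fun c => tsum_vertexOfM_left_cov_word_eq_zero hLc1 hr sf sm (j + 1) hM hδM hMcov hVW hδ hWcov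
    (fun y s => face_weight_periodic Lc α y s) (fun w s => face_weight_periodic Lc β w s) hρα hρβ μ ν (Sum.inl α) (Sum.inl β) c
  have z33 : ∀ c : Site (d + 1), _ := fun c => tsum_right_vertexOfM_word_eq_zero hLc1 hr sf sm (j + 1) hM hδM (hLM μ c) hρα hρβ ν (Sum.inl α) (Sum.inl β)
  simp only [z12, z13, z21, z22, z23, z31, z32, z33, Finset.sum_const_zero, add_zero]

/-- [folklore] **30_{j+1}, SWAP: THE SWAP EXCHANGE WORD OF THE DRESSED LEVEL-`(j+1)` SOURCE'S ff ZERO MODE IS ITS SWAP `S^E ⊗ S^E` LATTICE WORD** (same data). -/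
theorem sum_box_tsum_swap_word_eq_ee_succ (hLc : 3 ≤ Lc) (hr : r ∈ box (d + 1) Lc) (sf sm cΛ : ℝ) (j : ℕ) (hM : VertexFamily M Lc CM δM) (hδM : 0 < δM)
    (hMcov : ∀ (ρ' : Fin (d + 1)) (w t : Site (d + 1)), M ρ' (w + t) = shiftK (-((Lc : ℤ) • t)) (M ρ' w)) :
    ∑ c ∈ box (d + 1) Lc, ∑' u' : Site (d + 1), ∑' yw : Site (d + 1) × Site (d + 1), (if yw.1 α % (Lc : ℤ) = (Lc : ℤ) - 1 then (1 : ℝ) else 0) * (if yw.2 β % (Lc : ℤ) = (Lc : ℤ) - 1 then (1 : ℝ) else 0) *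
        comp (comp (dM (unitK sf sm (coDressKBmAt (toSite r) Lc (KInvStep (d := d) Lc (j + 1)))) Lc
            (unitS sf sm (SpureRecAt d Lc (toSite r) ((Lc : ℝ) ^ (d + 1)) (-((Lc : ℝ) ^ (d + 1) * (1 / 2) * (Lc : ℝ) ^ (d + 1))) cΛ (j + 1))) M ν u')
          (unitK sf sm (coDressKBmAt (toSite r) Lc (KInvStep (d := d) Lc (j + 1)))))
          (dM (unitK sf sm (coDressKBmAt (toSite r) Lc (KInvStep (d := d) Lc (j + 1)))) Lc
            (unitS sf sm (SpureRecAt d Lc (toSite r) ((Lc : ℝ) ^ (d + 1)) (-((Lc : ℝ) ^ (d + 1) * (1 / 2) * (Lc : ℝ) ^ (d + 1))) cΛ (j + 1))) M μ (toSite c)) yw.1 yw.2 (Sum.inl α) (Sum.inl β) =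
      ∑ c ∈ box (d + 1) Lc, ∑' u' : Site (d + 1), ∑' yw : Site (d + 1) × Site (d + 1), (if yw.1 α % (Lc : ℤ) = (Lc : ℤ) - 1 then (1 : ℝ) else 0) * (if yw.2 β % (Lc : ℤ) = (Lc : ℤ) - 1 then (1 : ℝ) else 0) *
        comp (comp (vertexOfK (unitK sf sm (coDressKBmAt (toSite r) Lc (KInvStep (d := d) Lc (j + 1)))) Lc
            (unitS sf sm (fun κ t => ((Lc : ℝ) ^ (d + 1) * wE d Lc (j + 1)) • e3OfK Lc (coDressKBmAt (toSite r) Lc (KInvStep (d := d) Lc j))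
              (SrecAt d Lc (toSite r) ((Lc : ℝ) ^ (d + 1)) (-((Lc : ℝ) ^ (d + 1) * (1 / 2) * (Lc : ℝ) ^ (d + 1))) cΛ j) κ t)) ν u')
          (unitK sf sm (coDressKBmAt (toSite r) Lc (KInvStep (d := d) Lc (j + 1)))))
          (vertexOfK (unitK sf sm (coDressKBmAt (toSite r) Lc (KInvStep (d := d) Lc (j + 1)))) Lc
            (unitS sf sm (fun κ t => ((Lc : ℝ) ^ (d + 1) * wE d Lc (j + 1)) • e3OfK Lc (coDressKBmAt (toSite r) Lc (KInvStep (d := d) Lc j))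
              (SrecAt d Lc (toSite r) ((Lc : ℝ) ^ (d + 1)) (-((Lc : ℝ) ^ (d + 1) * (1 / 2) * (Lc : ℝ) ^ (d + 1))) cΛ j) κ t)) μ (toSite c)) yw.1 yw.2 (Sum.inl α) (Sum.inl β) := by
  classical
  have hLc1 : 1 ≤ Lc := le_trans (by norm_num) hLc
  obtain ⟨δ, CX, Cv, Cw, Cm, hδ, hXd, hVE, hVW, hVM⟩ := exists_sector_data_succ hr sf sm ((Lc : ℝ) ^ (d + 1)) (-((Lc : ℝ) ^ (d + 1) * (1 / 2) * (Lc : ℝ) ^ (d + 1))) cΛ j hM hδM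
  have hX : Spr (unitK sf sm (coDressKBmAt (toSite r) Lc (KInvStep (d := d) Lc (j + 1)))) := ⟨_, _, hδ, hXd⟩
  have hLE := fun (κ : Fin (d + 1)) (u : Site (d + 1)) => (⟨_, _, _, _, hδ, hVE κ u⟩ : Loc _)
  have hLW := fun (κ : Fin (d + 1)) (u : Site (d + 1)) => (⟨_, _, _, _, hδ, hVW κ u⟩ : Loc _)
  have hLM := fun (κ : Fin (d + 1)) (u : Site (d + 1)) => (⟨_, _, _, _, hδ, hVM κ u⟩ : Loc _)
  have hρα : ∀ y : Site (d + 1), |(if y α % (Lc : ℤ) = (Lc : ℤ) - 1 then (1 : ℝ) else 0)| ≤ 1 := fun y => by split_ifs <;> simp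
  have hρβ : ∀ w : Site (d + 1), |(if w β % (Lc : ℤ) = (Lc : ℤ) - 1 then (1 : ℝ) else 0)| ≤ 1 := fun w => by split_ifs <;> simp
  have hEcov := fun (κ : Fin (d + 1)) (u t : Site (d + 1)) => vertexE_translate (r := r) hLc1 sf sm ((Lc : ℝ) ^ (d + 1)) (-((Lc : ℝ) ^ (d + 1) * (1 / 2) * (Lc : ℝ) ^ (d + 1))) cΛ j κ u t
  have hWcov := fun (κ : Fin (d + 1)) (u t : Site (d + 1)) =>
    borderSlot_translate (r := r) (S' := fun κ v => (-((Lc : ℝ) ^ (d + 1) * (1 / 2) * (Lc : ℝ) ^ (d + 1)) * wVH d Lc (j + 1)) • vhSAt (toSite r) d Lc rfl κ v) hLc1 sf sm (j + 1)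
      (vhS_translate (r := r) hLc1 (-((Lc : ℝ) ^ (d + 1) * (1 / 2) * (Lc : ℝ) ^ (d + 1)) * wVH d Lc (j + 1))) κ u t
  have hSV := locStencil_vhS hLc1 hr (-((Lc : ℝ) ^ (d + 1) * (1 / 2) * (Lc : ℝ) ^ (d + 1)) * wVH d Lc (j + 1)) zero_le_one
  simp only [dM_dressed_succ_split hr sf sm ((Lc : ℝ) ^ (d + 1)) (-((Lc : ℝ) ^ (d + 1) * (1 / 2) * (Lc : ℝ) ^ (d + 1))) cΛ j M]
  rw [Finset.sum_congr rfl fun c _ => tsum_swap_word_split (hLE μ (toSite c)) (hLW μ (toSite c)) (hLM μ (toSite c)) hX hVE hδ hVW hδ hVM hδ hρα hρβ ν (Sum.inl α) (Sum.inl β)]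
  simp only [Finset.sum_add_distrib]
  -- the eight sector zeros (left slot on the lattice bond)
  have z12 : ∀ c : Site (d + 1), _ := fun c => EvH_swap_word_eq_zero_succ (μ := μ) (ν := ν) (α := α) (β := β) hLc hr sf sm cΛ j hSV one_pos (vhS_inl_inl (r := r) _) c
  have z13 : ∀ c : Site (d + 1), _ := fun c => tsum_vertexOfM_right_cov_word_eq_zero hLc1 hr sf sm (j + 1) hM hδM hMcov hVE hδ hEcov
    (fun y s => face_weight_periodic Lc α y s) (fun w s => face_weight_periodic Lc β w s) hρα hρβ μ ν (Sum.inl α) (Sum.inl β) c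
  have z21 := sum_box_border_E_swap_word_eq_zero_succ (μ := μ) (ν := ν) (α := α) (β := β) hLc hr sf sm cΛ j hSV one_pos
    (vhS_inl_inl (r := r) _) (vhS_translate (r := r) hLc1 _) (vhS_inr_snd_eq_zero (r := r) _)
  have z22 := (sum_box_vh_vh_words_eq_zero (μ := μ) (ν := ν) (α := α) (β := β) hLc1 hr sf sm (-((Lc : ℝ) ^ (d + 1) * (1 / 2) * (Lc : ℝ) ^ (d + 1)) * wVH d Lc (j + 1)) (j + 1) Lc).2
  have z23 : ∀ c : Site (d + 1), _ := fun c => tsum_vertexOfM_right_cov_word_eq_zero hLc1 hr sf sm (j + 1) hM hδM hMcov hVW hδ hWcov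
    (fun y s => face_weight_periodic Lc α y s) (fun w s => face_weight_periodic Lc β w s) hρα hρβ μ ν (Sum.inl α) (Sum.inl β) c
  have z31 : ∀ c : Site (d + 1), _ := fun c => tsum_left_vertexOfM_word_eq_zero hLc1 hr sf sm (j + 1) hM hδM (hLE μ c) hρα hρβ ν (Sum.inl α) (Sum.inl β)
  have z32 : ∀ c : Site (d + 1), _ := fun c => tsum_left_vertexOfM_word_eq_zero hLc1 hr sf sm (j + 1) hM hδM (hLW μ c) hρα hρβ ν (Sum.inl α) (Sum.inl β)
  have z33 : ∀ c : Site (d + 1), _ := fun c => tsum_left_vertexOfM_word_eq_zero hLc1 hr sf sm (j + 1) hM hδM (hLM μ c) hρα hρβ ν (Sum.inl α) (Sum.inl β)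
  simp only [z12, z13, z21, z22, z23, z31, z32, z33, Finset.sum_const_zero, add_zero]

end Summit.QuantumFields.BalabanUV.Beta.GAN24.DressedSourceExchangeWordsSucc

end

noncomputable section

open Finset
open scoped BigOperators
open Literature.MathematicalPhysics.QuantumFieldTheory
open Literature.MathematicalPhysics.QuantumFieldTheory.Balaban1983to89
open Literature.MathematicalPhysics.QuantumFieldTheory.Balaban1983to89.Beta
open ExpKernelCalculus (Site MKer comp shiftK Decays BiLoc VertexFamily)
open OneStepResolventKernel (Fib LocStencil decays_mono biLoc_mono)
open OneStepKernelFamily (KInvStep vertexOfK decays_KInvStep)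
open BalabanStepJets (locStencil_mono)
open BalabanCompositeJets (LocStencil₂)
open SecondOrderResponse (dM K2OfK W2SymOfK LocStencilFM vertexFamily_dM vertexFamily₂_W2SymOfK')
open BalabanStepW2 (K3OfK)
open BalabanStepJetsSucc (mmRead wE)
open AffineAveraging (box toSite)
open Summit.QuantumFields.BalabanUV.Beta.TameKernelCalculus (Loc Spr)
open Summit.QuantumFields.BalabanUV.Beta.AxialDressingRooted (coDressKBmAt decays_coDressKBmAt)
open Summit.QuantumFields.BalabanUV.Beta.HessKerDressedUnits (unitK unitS decays_unitK locStencil_unitS)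
open Summit.QuantumFields.BalabanUV.Beta.SpineRooted (e3OfK SpureRecAt locStencil_SpureRecAt SpureRecAt_translate)
open Summit.QuantumFields.BalabanUV.Beta.WardLocusRecursive (SrecAt)
open Summit.QuantumFields.BalabanUV.Beta.GAN24.BiStencilZeroMode (Tab zmode)
open Summit.QuantumFields.BalabanUV.Beta.GAN24.ExchangeSlotResum (face_weight_periodic)
open Summit.QuantumFields.BalabanUV.Beta.GAN24.VHWordsZeroBorder (unitS_translate_block)
open Summit.QuantumFields.BalabanUV.Beta.GAN24.DressedSourceZeroModeWords (zmode_dressedSource_inl_inl_of_summable)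
open Summit.QuantumFields.BalabanUV.Beta.GAN24.DressedSourceExchangeWords (summable_right_word summable_left_word)
open Summit.QuantumFields.BalabanUV.Beta.GAN24.WWordRespSummable (sum_box_tsum_W_word_eq_half_outer_resp summable_twoFace_W2SymOfK_dressedStep_bond)
open Summit.QuantumFields.BalabanUV.Beta.GAN24.DressedSourceExchangeWordsSucc (sum_box_tsum_direct_word_eq_ee_succ sum_box_tsum_swap_word_eq_ee_succ)
open Summit.QuantumFields.BalabanUV.Beta.GAN24.RespWordsAllLevels (respWords_add_swap_eq_zero)
open SecondOrderResponse (biLoc_smul)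
open BalabanStepW2 (M2Of locStencilFM_M2Of M2Of_translate)
open AveragingMixedJetTables (mixFFAt)
open Summit.QuantumFields.BalabanUV.Beta.HessKerDressedUnits (counitK counitK_apply biLoc_counitK)
open Summit.QuantumFields.BalabanUV.Beta.SecondOrderUnits (unitM unitM₂ unitM_apply)
open Summit.QuantumFields.BalabanUV.Beta.SpineRooted (M1At vertexFamily_M1At M1At_translate)
open Summit.QuantumFields.BalabanUV.Beta.MixedJetTablesPlug (hmix_an1 hmixt_an1)
open Summit.QuantumFields.BalabanUV.Beta.GAN24.DressedSourceZeroModeLevelZero (locStencilFM_unitM₂)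

namespace Summit.QuantumFields.BalabanUV.Beta.GAN24.DressedSourceZeroModeSucc

variable {d : ℕ} {Lc : ℕ} [NeZero Lc] {r : Fin (d + 1) → ℕ}
  {M : Fin (d + 1) → Site (d + 1) → MKer (d + 1) (Fib d)} {CM δM : ℝ}
  {M₂ : Fin (d + 1) → Site (d + 1) → Fin (d + 1) → Site (d + 1) → MKer (d + 1) (Fib d)} {C₂ δ₂ : ℝ}

/-- [folklore] **ONE RATE FOR ALL THE LEVEL-`j` SHAPES** (33's `exists_level0_data` with `0 ↦ j`). -/
theorem exists_succ_data (hLc : 1 ≤ Lc) (hr : r ∈ box (d + 1) Lc) (sf sm cE cVH cΛ : ℝ) (j : ℕ) (hM : VertexFamily M Lc CM δM) (hδM : 0 < δM) :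
    ∃ m CX Cs Cv : ℝ, 0 < m ∧ Decays (unitK sf sm (coDressKBmAt (toSite r) Lc (KInvStep (d := d) Lc j))) CX m ∧
      LocStencil (unitS sf sm (SpureRecAt d Lc (toSite r) cE cVH cΛ j)) Cs m ∧ VertexFamily M Lc CM m ∧
      VertexFamily (dM (unitK sf sm (coDressKBmAt (toSite r) Lc (KInvStep (d := d) Lc j))) Lc (unitS sf sm (SpureRecAt d Lc (toSite r) cE cVH cΛ j)) M) Lc Cv m := by
  obtain ⟨δK, CK, hδK, hCK, hXd⟩ := decays_coDressKBmAt hLc hr (decays_KInvStep (d := d) (Lc := Lc) j)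
  have hXu := decays_unitK (sf := sf) (sm := sm) hXd
  have hCX : 0 ≤ max |sf| |sm| * CK * max |sf| |sm| := by positivity
  obtain ⟨Cs₀, δs, hδs, hS₀⟩ := locStencil_SpureRecAt hLc hr cE cVH cΛ j
  have hS := locStencil_unitS (sf := sf) (sm := sm) hS₀
  have hCs : 0 ≤ |(sf * sm)⁻¹| * (max |sf⁻¹| |sm⁻¹| * Cs₀ * max |sf⁻¹| |sm⁻¹|) := (hS 0 0).nonneg (Sum.inl 0)
  have hCM : 0 ≤ CM := (hM 0 0).nonneg (Sum.inl 0)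
  set m₁ : ℝ := min (min δK δs) δM with hm₁
  have hm₁0 : 0 < m₁ := lt_min (lt_min hδK hδs) hδM
  have hX1 : Decays (unitK sf sm (coDressKBmAt (toSite r) Lc (KInvStep (d := d) Lc j))) (max |sf| |sm| * CK * max |sf| |sm|) m₁ :=
    decays_mono hXu hCX le_rfl ((min_le_left _ _).trans (min_le_left _ _))
  have hS1 := locStencil_mono hS hCs ((min_le_left _ _).trans (min_le_right _ _) : m₁ ≤ δs)
  have hM1 : VertexFamily M Lc CM m₁ := fun ρ' w => biLoc_mono (hM ρ' w) hCM (min_le_right _ _)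
  have hV := vertexFamily_dM (N := Lc) hX1 hCX hS1 hM1 hm₁0 le_rfl
  refine ⟨m₁ / 2, _, _, _, half_pos hm₁0, decays_mono hX1 hCX le_rfl (by linarith), locStencil_mono hS1 hCs (by linarith),
    fun ρ' w => biLoc_mono (hM1 ρ' w) hCM (by linarith), hV⟩

/-- [folklore] **THE ff ZERO MODE OF THE DRESSED LEVEL-`(j+1)` SOURCE IS ITS TWO `S^E ⊗ S^E` LATTICE WORDS** (E's pins, `3 ≤ Lc`; the multiplier, border, mixed and response words all vanish
— 23, 24_{j+1}, 26, 27_{j+1}, 31, (L3c)_{j+1}):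
`zmode Lc (c•mmRead Lc (K3OfK X̃♮_{j+1} Lc S♮_{j+1} M W̃) + cB•B)(μ,ν; inl α, inl β) = c·(−(s_f s_m σ_{j+1})²Lc²)·(EE_direct + EE_swap)`. -/
theorem zmode_dressedSource_succ_inl_inl (hLc : 3 ≤ Lc) (hr : r ∈ box (d + 1) Lc) (sf sm cΛ : ℝ) (j : ℕ)
    (hM : VertexFamily M Lc CM δM) (hδM : 0 < δM) (hMcov : ∀ (ρ' : Fin (d + 1)) (w t : Site (d + 1)), M ρ' (w + t) = shiftK (-((Lc : ℤ) • t)) (M ρ' w))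
    (hM₂ : LocStencilFM Lc M₂ C₂ δ₂) (hδ₂ : 0 < δ₂)
    (hM₂t : ∀ (κ : Fin (d + 1)) (u : Site (d + 1)) (ρ' : Fin (d + 1)) (w t : Site (d + 1)),
      M₂ κ (u + (Lc : ℤ) • t) ρ' (w + t) = shiftK (-((Lc : ℤ) • t)) (M₂ κ u ρ' w))
    {B : Tab d} (hBff : ∀ κ u κ' u' x z (α β : Fin (d + 1)), B κ u κ' u' x z (Sum.inl α) (Sum.inl β) = 0) (c cB : ℝ) (μ ν α β : Fin (d + 1)) :
    zmode Lc (fun κ u κ' u' => c • mmRead Lc (K3OfK (unitK sf sm (coDressKBmAt (toSite r) Lc (KInvStep (d := d) Lc (j + 1)))) Lc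
        (unitS sf sm (SpureRecAt d Lc (toSite r) ((Lc : ℝ) ^ (d + 1)) (-((Lc : ℝ) ^ (d + 1) * (1 / 2) * (Lc : ℝ) ^ (d + 1))) cΛ (j + 1))) M
        (W2SymOfK (unitK sf sm (coDressKBmAt (toSite r) Lc (KInvStep (d := d) Lc (j + 1)))) Lc
          (unitS sf sm (SpureRecAt d Lc (toSite r) ((Lc : ℝ) ^ (d + 1)) (-((Lc : ℝ) ^ (d + 1) * (1 / 2) * (Lc : ℝ) ^ (d + 1))) cΛ (j + 1))) M 0 M₂) κ u κ' u')
        + cB • B κ u κ' u') μ ν (Sum.inl α) (Sum.inl β) =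
      c * (-((sf * sm * ((((Lc ^ (j + 1 + 1) : ℕ) : ℝ)) ^ (d + 1 + 1))⁻¹) * (sf * sm * ((((Lc ^ (j + 1 + 1) : ℕ) : ℝ)) ^ (d + 1 + 1))⁻¹)) * ((Lc : ℝ) * (Lc : ℝ))) *
        ((∑ c' ∈ box (d + 1) Lc, ∑' u' : Site (d + 1), ∑' yw : Site (d + 1) × Site (d + 1), (if yw.1 α % (Lc : ℤ) = (Lc : ℤ) - 1 then (1 : ℝ) else 0) * (if yw.2 β % (Lc : ℤ) = (Lc : ℤ) - 1 then (1 : ℝ) else 0) *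
            comp (comp (vertexOfK (unitK sf sm (coDressKBmAt (toSite r) Lc (KInvStep (d := d) Lc (j + 1)))) Lc
                (unitS sf sm (fun κ t => ((Lc : ℝ) ^ (d + 1) * wE d Lc (j + 1)) • e3OfK Lc (coDressKBmAt (toSite r) Lc (KInvStep (d := d) Lc j))
                  (SrecAt d Lc (toSite r) ((Lc : ℝ) ^ (d + 1)) (-((Lc : ℝ) ^ (d + 1) * (1 / 2) * (Lc : ℝ) ^ (d + 1))) cΛ j) κ t)) μ (toSite c'))
              (unitK sf sm (coDressKBmAt (toSite r) Lc (KInvStep (d := d) Lc (j + 1)))))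
              (vertexOfK (unitK sf sm (coDressKBmAt (toSite r) Lc (KInvStep (d := d) Lc (j + 1)))) Lc
                (unitS sf sm (fun κ t => ((Lc : ℝ) ^ (d + 1) * wE d Lc (j + 1)) • e3OfK Lc (coDressKBmAt (toSite r) Lc (KInvStep (d := d) Lc j))
                  (SrecAt d Lc (toSite r) ((Lc : ℝ) ^ (d + 1)) (-((Lc : ℝ) ^ (d + 1) * (1 / 2) * (Lc : ℝ) ^ (d + 1))) cΛ j) κ t)) ν u') yw.1 yw.2 (Sum.inl α) (Sum.inl β)) +
          ∑ c' ∈ box (d + 1) Lc, ∑' u' : Site (d + 1), ∑' yw : Site (d + 1) × Site (d + 1), (if yw.1 α % (Lc : ℤ) = (Lc : ℤ) - 1 then (1 : ℝ) else 0) * (if yw.2 β % (Lc : ℤ) = (Lc : ℤ) - 1 then (1 : ℝ) else 0) *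
            comp (comp (vertexOfK (unitK sf sm (coDressKBmAt (toSite r) Lc (KInvStep (d := d) Lc (j + 1)))) Lc
                (unitS sf sm (fun κ t => ((Lc : ℝ) ^ (d + 1) * wE d Lc (j + 1)) • e3OfK Lc (coDressKBmAt (toSite r) Lc (KInvStep (d := d) Lc j))
                  (SrecAt d Lc (toSite r) ((Lc : ℝ) ^ (d + 1)) (-((Lc : ℝ) ^ (d + 1) * (1 / 2) * (Lc : ℝ) ^ (d + 1))) cΛ j) κ t)) ν u')
              (unitK sf sm (coDressKBmAt (toSite r) Lc (KInvStep (d := d) Lc (j + 1)))))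
              (vertexOfK (unitK sf sm (coDressKBmAt (toSite r) Lc (KInvStep (d := d) Lc (j + 1)))) Lc
                (unitS sf sm (fun κ t => ((Lc : ℝ) ^ (d + 1) * wE d Lc (j + 1)) • e3OfK Lc (coDressKBmAt (toSite r) Lc (KInvStep (d := d) Lc j))
                  (SrecAt d Lc (toSite r) ((Lc : ℝ) ^ (d + 1)) (-((Lc : ℝ) ^ (d + 1) * (1 / 2) * (Lc : ℝ) ^ (d + 1))) cΛ j) κ t)) μ (toSite c')) yw.1 yw.2 (Sum.inl α) (Sum.inl β)) := by
  classical
  have hLc1 : 1 ≤ Lc := le_trans (by norm_num) hLc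
  obtain ⟨m, CX, Cs, Cv, hm, hXd, hS, hM', hV⟩ := exists_succ_data hLc1 hr sf sm ((Lc : ℝ) ^ (d + 1)) (-((Lc : ℝ) ^ (d + 1) * (1 / 2) * (Lc : ℝ) ^ (d + 1))) cΛ (j + 1) hM hδM
  have hCX : 0 ≤ CX := hXd.nonneg (Sum.inl 0)
  have hX : Spr (unitK sf sm (coDressKBmAt (toSite r) Lc (KInvStep (d := d) Lc (j + 1)))) := ⟨_, _, hm, hXd⟩
  have hb : ∀ (κ : Fin (d + 1)) (y : Site (d + 1)),
      Loc (dM (unitK sf sm (coDressKBmAt (toSite r) Lc (KInvStep (d := d) Lc (j + 1)))) Lc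
        (unitS sf sm (SpureRecAt d Lc (toSite r) ((Lc : ℝ) ^ (d + 1)) (-((Lc : ℝ) ^ (d + 1) * (1 / 2) * (Lc : ℝ) ^ (d + 1))) cΛ (j + 1))) M κ y) :=
    fun κ y => ⟨_, _, _, _, hm, hV κ y⟩
  have hz : LocStencil₂ (0 : Fin (d + 1) → (Fin (d + 1) → ℤ) → Fin (d + 1) → (Fin (d + 1) → ℤ) → MKer (d + 1) (Fib d)) 0 1 := by
    intro κ u κ' u' x z a b; simp
  obtain ⟨Cw, δw, hδw, hWF⟩ := vertexFamily₂_W2SymOfK' (N := Lc) ⟨m, CX, hm, hCX, hXd⟩ hS hm hM' hm hz one_pos hM₂ hδ₂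
  have hW : ∀ (κ : Fin (d + 1)) (y : Site (d + 1)) (κ' : Fin (d + 1)) (y' : Site (d + 1)),
      Loc (W2SymOfK (unitK sf sm (coDressKBmAt (toSite r) Lc (KInvStep (d := d) Lc (j + 1)))) Lc
        (unitS sf sm (SpureRecAt d Lc (toSite r) ((Lc : ℝ) ^ (d + 1)) (-((Lc : ℝ) ^ (d + 1) * (1 / 2) * (Lc : ℝ) ^ (d + 1))) cΛ (j + 1))) M 0 M₂ κ y κ' y') :=
    fun κ y κ' y' => ⟨_, _, _, _, hδw, hWF κ y κ' y'⟩
  have hρα : ∀ y : Site (d + 1), |(if y α % (Lc : ℤ) = (Lc : ℤ) - 1 then (1 : ℝ) else 0)| ≤ 1 := fun y => by split_ifs <;> simp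
  have hρβ : ∀ w : Site (d + 1), |(if w β % (Lc : ℤ) = (Lc : ℤ) - 1 then (1 : ℝ) else 0)| ≤ 1 := fun w => by split_ifs <;> simp
  have hSt : ∀ (κ : Fin (d + 1)) (u t : Site (d + 1)), unitS sf sm (SpureRecAt d Lc (toSite r) ((Lc : ℝ) ^ (d + 1)) (-((Lc : ℝ) ^ (d + 1) * (1 / 2) * (Lc : ℝ) ^ (d + 1))) cΛ (j + 1)) κ (u + (Lc : ℤ) • t) =
      shiftK (-((Lc : ℤ) • t)) (unitS sf sm (SpureRecAt d Lc (toSite r) ((Lc : ℝ) ^ (d + 1)) (-((Lc : ℝ) ^ (d + 1) * (1 / 2) * (Lc : ℝ) ^ (d + 1))) cΛ (j + 1)) κ u) :=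
    fun κ u t => unitS_translate_block (Lc := Lc) sf sm (fun κ u t => SpureRecAt_translate (toSite r) hLc1 _ _ cΛ (j + 1) κ u t) κ u t
  have h1 := fun u : Site (d + 1) => summable_right_word (Lc := Lc) (hb μ u) hX hV hm hρα hρβ ν (Sum.inl α) (Sum.inl β)
  have h2 := fun u : Site (d + 1) => summable_left_word (Lc := Lc) (hb μ u) hX hV hm hρα hρβ ν (Sum.inl α) (Sum.inl β)
  have h3 := fun u : Site (d + 1) => summable_twoFace_W2SymOfK_dressedStep_bond hLc1 hr sf sm (j + 1) hS hm hM' hm hM₂ hδ₂ hM₂t hρα hρβ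
    (fun y s => face_weight_periodic Lc α y s) (fun w s => face_weight_periodic Lc β w s) μ u ν (Sum.inl α) (Sum.inl β)
  rw [zmode_dressedSource_inl_inl_of_summable hLc1 hr sf sm (j + 1) c cB hb hW hBff Lc μ ν α β h1 h2 h3,
    sum_box_tsum_direct_word_eq_ee_succ hLc hr sf sm cΛ j hM hδM hMcov, sum_box_tsum_swap_word_eq_ee_succ hLc hr sf sm cΛ j hM hδM hMcov,
    sum_box_tsum_W_word_eq_half_outer_resp hLc1 hr sf sm (j + 1) hS hm hM' hm hM₂ hδ₂ hM₂t hSt hMcov Lc μ ν α β]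
  have hresp : ∀ c' : Site (d + 1), _ := fun c' => respWords_add_swap_eq_zero hLc1 hr sf sm ((Lc : ℝ) ^ (d + 1)) (-((Lc : ℝ) ^ (d + 1) * (1 / 2) * (Lc : ℝ) ^ (d + 1))) cΛ (j + 1)
    hM hδM hMcov ν μ α β c'
  simp only [hresp, Finset.sum_const_zero, mul_zero, sub_zero]

/-- [folklore] **THE SAME AT an1's TABLES** — p2's literal level-`(j+1)` source: `M = unitM s_f s_m (M1At d Lc ρ cΛ (j+1))` (an2's `vertexFamily_M1At` ∕ `M1At_translate`) and
`M₂ = unitM₂ s_f s_m (M2Of d Lc (mixFFAt ρ Lc) (j+1))` (an1's `hmix_an1` ∕ `hmixt_an1` through `locStencilFM_M2Of` ∕ `M2Of_translate`); only the ff-free border `B` stays generic. -/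
theorem zmode_dressedSource_succ_an1_inl_inl (hLc : 3 ≤ Lc) (hr : r ∈ box (d + 1) Lc) (sf sm cΛ : ℝ) (j : ℕ)
    {B : Tab d} (hBff : ∀ κ u κ' u' x z (α β : Fin (d + 1)), B κ u κ' u' x z (Sum.inl α) (Sum.inl β) = 0) (c cB : ℝ) (μ ν α β : Fin (d + 1)) :
    zmode Lc (fun κ u κ' u' => c • mmRead Lc (K3OfK (unitK sf sm (coDressKBmAt (toSite r) Lc (KInvStep (d := d) Lc (j + 1)))) Lc
        (unitS sf sm (SpureRecAt d Lc (toSite r) ((Lc : ℝ) ^ (d + 1)) (-((Lc : ℝ) ^ (d + 1) * (1 / 2) * (Lc : ℝ) ^ (d + 1))) cΛ (j + 1))) (unitM sf sm (M1At d Lc (toSite r) cΛ (j + 1)))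
        (W2SymOfK (unitK sf sm (coDressKBmAt (toSite r) Lc (KInvStep (d := d) Lc (j + 1)))) Lc
          (unitS sf sm (SpureRecAt d Lc (toSite r) ((Lc : ℝ) ^ (d + 1)) (-((Lc : ℝ) ^ (d + 1) * (1 / 2) * (Lc : ℝ) ^ (d + 1))) cΛ (j + 1)))
          (unitM sf sm (M1At d Lc (toSite r) cΛ (j + 1))) 0 (unitM₂ sf sm (M2Of d Lc (mixFFAt (toSite r) Lc) (j + 1)))) κ u κ' u')
        + cB • B κ u κ' u') μ ν (Sum.inl α) (Sum.inl β) =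
      c * (-((sf * sm * ((((Lc ^ (j + 1 + 1) : ℕ) : ℝ)) ^ (d + 1 + 1))⁻¹) * (sf * sm * ((((Lc ^ (j + 1 + 1) : ℕ) : ℝ)) ^ (d + 1 + 1))⁻¹)) * ((Lc : ℝ) * (Lc : ℝ))) *
        ((∑ c' ∈ box (d + 1) Lc, ∑' u' : Site (d + 1), ∑' yw : Site (d + 1) × Site (d + 1), (if yw.1 α % (Lc : ℤ) = (Lc : ℤ) - 1 then (1 : ℝ) else 0) * (if yw.2 β % (Lc : ℤ) = (Lc : ℤ) - 1 then (1 : ℝ) else 0) *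
            comp (comp (vertexOfK (unitK sf sm (coDressKBmAt (toSite r) Lc (KInvStep (d := d) Lc (j + 1)))) Lc
                (unitS sf sm (fun κ t => ((Lc : ℝ) ^ (d + 1) * wE d Lc (j + 1)) • e3OfK Lc (coDressKBmAt (toSite r) Lc (KInvStep (d := d) Lc j))
                  (SrecAt d Lc (toSite r) ((Lc : ℝ) ^ (d + 1)) (-((Lc : ℝ) ^ (d + 1) * (1 / 2) * (Lc : ℝ) ^ (d + 1))) cΛ j) κ t)) μ (toSite c'))
              (unitK sf sm (coDressKBmAt (toSite r) Lc (KInvStep (d := d) Lc (j + 1)))))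
              (vertexOfK (unitK sf sm (coDressKBmAt (toSite r) Lc (KInvStep (d := d) Lc (j + 1)))) Lc
                (unitS sf sm (fun κ t => ((Lc : ℝ) ^ (d + 1) * wE d Lc (j + 1)) • e3OfK Lc (coDressKBmAt (toSite r) Lc (KInvStep (d := d) Lc j))
                  (SrecAt d Lc (toSite r) ((Lc : ℝ) ^ (d + 1)) (-((Lc : ℝ) ^ (d + 1) * (1 / 2) * (Lc : ℝ) ^ (d + 1))) cΛ j) κ t)) ν u') yw.1 yw.2 (Sum.inl α) (Sum.inl β)) +
          ∑ c' ∈ box (d + 1) Lc, ∑' u' : Site (d + 1), ∑' yw : Site (d + 1) × Site (d + 1), (if yw.1 α % (Lc : ℤ) = (Lc : ℤ) - 1 then (1 : ℝ) else 0) * (if yw.2 β % (Lc : ℤ) = (Lc : ℤ) - 1 then (1 : ℝ) else 0) *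
            comp (comp (vertexOfK (unitK sf sm (coDressKBmAt (toSite r) Lc (KInvStep (d := d) Lc (j + 1)))) Lc
                (unitS sf sm (fun κ t => ((Lc : ℝ) ^ (d + 1) * wE d Lc (j + 1)) • e3OfK Lc (coDressKBmAt (toSite r) Lc (KInvStep (d := d) Lc j))
                  (SrecAt d Lc (toSite r) ((Lc : ℝ) ^ (d + 1)) (-((Lc : ℝ) ^ (d + 1) * (1 / 2) * (Lc : ℝ) ^ (d + 1))) cΛ j) κ t)) ν u')
              (unitK sf sm (coDressKBmAt (toSite r) Lc (KInvStep (d := d) Lc (j + 1)))))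
              (vertexOfK (unitK sf sm (coDressKBmAt (toSite r) Lc (KInvStep (d := d) Lc (j + 1)))) Lc
                (unitS sf sm (fun κ t => ((Lc : ℝ) ^ (d + 1) * wE d Lc (j + 1)) • e3OfK Lc (coDressKBmAt (toSite r) Lc (KInvStep (d := d) Lc j))
                  (SrecAt d Lc (toSite r) ((Lc : ℝ) ^ (d + 1)) (-((Lc : ℝ) ^ (d + 1) * (1 / 2) * (Lc : ℝ) ^ (d + 1))) cΛ j) κ t)) μ (toSite c')) yw.1 yw.2 (Sum.inl α) (Sum.inl β)) := by
  have hLc1 : 1 ≤ Lc := le_trans (by norm_num) hLc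
  obtain ⟨C₂, δ₂, hδ₂, hmix⟩ := hmix_an1 hLc1 hr
  have hM : VertexFamily (unitM sf sm (M1At d Lc (toSite r) cΛ (j + 1))) Lc
      (|(sm * sm)⁻¹| * (max |sf⁻¹| |sm⁻¹| * (|cΛ * BalabanStepW2.wM1 d Lc (j + 1)| * (2 * (AveragingHessianKernels.ell (d + 1) Lc : ℝ) ^ 2 * Real.exp (4 * ((d : ℝ) + 1) * Lc * 1))) *
        max |sf⁻¹| |sm⁻¹|)) 1 :=
    fun ρ' w => biLoc_smul ((sm * sm)⁻¹) (biLoc_counitK (vertexFamily_M1At hLc1 hr cΛ (j + 1) zero_le_one ρ' w))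
  have hMcov : ∀ (ρ' : Fin (d + 1)) (w t : Site (d + 1)),
      unitM sf sm (M1At d Lc (toSite r) cΛ (j + 1)) ρ' (w + t) = shiftK (-((Lc : ℤ) • t)) (unitM sf sm (M1At d Lc (toSite r) cΛ (j + 1)) ρ' w) := by
    intro ρ' w t
    funext x z a b
    simp only [unitM_apply, shiftK, M1At_translate (Lc := Lc) (toSite r) cΛ (j + 1) ρ' w t]
  have hM₂ := locStencilFM_unitM₂ (Lc := Lc) (M₂ := M2Of d Lc (mixFFAt (toSite r) Lc) (j + 1)) sf sm (locStencilFM_M2Of hmix (j + 1))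
  have hM₂t : ∀ (κ : Fin (d + 1)) (u : Site (d + 1)) (ρ' : Fin (d + 1)) (w t : Site (d + 1)),
      unitM₂ sf sm (M2Of d Lc (mixFFAt (toSite r) Lc) (j + 1)) κ (u + (Lc : ℤ) • t) ρ' (w + t) =
        shiftK (-((Lc : ℤ) • t)) (unitM₂ sf sm (M2Of d Lc (mixFFAt (toSite r) Lc) (j + 1)) κ u ρ' w) := by
    intro κ u ρ' w t
    funext x z a b
    simp only [unitM₂, unitM, Pi.smul_apply, smul_eq_mul, counitK_apply, shiftK, M2Of_translate (hmixt_an1 (toSite r)) (j + 1) κ u ρ' w t]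
  exact zmode_dressedSource_succ_inl_inl hLc hr sf sm cΛ j hM one_pos hMcov hM₂ hδ₂ hM₂t hBff c cB μ ν α β

end Summit.QuantumFields.BalabanUV.Beta.GAN24.DressedSourceZeroModeSucc

end
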